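import Summits.RiemannHypothesis.RiemannHypothesis.Theorems.SemilocalDeletionToeplitzFloor
import HarnessLib

/-!
# The ALL-WINDOW deletion floor `2·log p/(1 + √p)`: the Kac–Murdock–Szegő bound by a causal filter

`SemilocalDeletionToeplitzFloor.lean` reduced the cost of deleting a prime `p ∈ S` from the semi-local Weil form on a window
`[−c, c]` with `m` visible powers (`2c < (m+1)·log p`) to a FIBRE CERTIFICATE: `A_m(p) + μ·I ⪰ 0` for the zero-diagonal Toeplitz
section `A_m(p) = [log p · p^{−|i−j|/2}]_{i≠j}`, i.e. `A_m(p) = log p · (K_{m+1}(ρ) − I)` with `K_n(ρ) = [ρ^{|i−j|}]` the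
Kac–Murdock–Szegő matrix at `ρ = 1/√p`.  The companion files certify the SHARP constants `−λ_min(A_m(p))` for small `m`
(cubic/quartic roots, one window at a time).  Here we prove the bound that holds for EVERY `m`, hence on EVERY window:

  `K_n(ρ) ⪰ (1 − ρ)/(1 + ρ) · I`  for `0 ≤ ρ ≤ 1` and all `n`   (`kms_offdiag_real`, the minimum of the KMS symbol
  `(1 − ρ²)/(1 − 2ρ cos θ + ρ²)` at `θ = π`),

so `A_m(p) ⪰ −(2ρ/(1+ρ))·log p = −2·log p/(√p + 1)` (`cert_uniform`) and therefore (§3)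

* `re_weilSemilocalQuadratic_erase_ge_uniform` / `…_uniform'`: `Re Q_{S∖{p}}(g) ≥ Re Q_S(g) − (2·log p/(√p + 1))·‖g‖₂²` for every Weil
  test function `g` — NO window hypothesis (the primed form has no support hypothesis at all);
* `semilocalGroundEnergy_erase_ge_uniform`: `λ_min(S∖{p}; c; P) ≥ λ_min(S; c; P) − 2·log p/(√p + 1)` for every `c`, every finite
  `S ∋ p`, every constraint `P`;
* `semilocalGroundEnergy_sdiff_ge_uniform`: deleting a set `T` of primes costs at most `Σ_{p ∈ T} 2·log p/(√p + 1)`, on every window;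
  `semilocalGroundEnergy_ge_of_subset_uniform` (`S ⊆ S'`) and `semilocalGroundEnergy_le_empty_add_sum` (the primes' total budget
  `λ_min(S; c; P) ≤ λ_min(∅; c; P) + Σ_{p∈S} 2·log p/(√p + 1)`) are the same statement read as a modulus of monotonicity.

Values: `p = 2`: `0.574222`, `p = 3`: `0.804240`, `p = 5`: `0.994687`, `p = 7`: `1.067495` — the limits `m → ∞` of the sharp
window-by-window floors (`p = 2`: `0.5412, 0.5563, 0.5629, 0.5664, 0.5685, … ↑ 0.5742`), `6 %` (`p = 2`) … `17 %` (`p = 7`) above them from `m = 2` on; against the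
single-atom cliff `log p/√p` the all-window cost is the factor `2/(1+ρ) = 2√p/(√p+1) ∈ [1.17, 2)` (`1.17` at `p = 2`, `1.45` at `p = 7`).

THE PROOF is finite and elementary (no Fourier analysis): with the causal filter `u_i = Σ_{j ≤ i} ρ^{i−j} x_j` one has the identity
`xᵀ K x = (1 − ρ²)·Σ u_i² + ρ²·u_n²` and the comparison `Σ x_i² = Σ (u_i − ρ u_{i−1})² ≤ (1 + ρ)²·Σ u_i²` (`causal_filter_aux`,
by induction on `n`); the two-sided fibre form is the average of a causal and an anticausal (reflected) copy.

Nothing here bears on RH; these are statements about truncated Weil forms.  [KMS: M. Kac, W. L. Murdock, G. Szegő, *On the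
eigenvalues of certain Hermitian forms*, J. Rational Mech. Anal. 2 (1953), used only as a name for `[ρ^{|i−j|}]`.]
-/

set_option linter.dupNamespace false

noncomputable section

open Complex Filter Set MeasureTheory
open scoped Real Topology ComplexConjugate

namespace Summit.RiemannHypothesis.RiemannHypothesis.Theorems.SemilocalDeletionToeplitzFloorUniform

open Literature.NumberTheory.LFunctions
open Summit.RiemannHypothesis.RiemannHypothesis.Theorems.SemilocalDeletionToeplitzFloor
open Summit.RiemannHypothesis.RiemannHypothesis.Theorems.SemilocalDeletionCliff
open Summit.RiemannHypothesis.RiemannHypothesis.Theorems.HandoffSemilocalEnergy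

/-! ## §1  `K_n(ρ) ⪰ (1−ρ)/(1+ρ)` by a causal filter -/

/-- Causal-filter bookkeeping: if `v₀ = 0` and `v_{i+1} = ρ·(v_i + x_i)` for `i < n` (so `v_i = Σ_{j<i} ρ^{i−j} x_j` and
`u := x + v` is the causal filter of `x`), then `Σ_{i≤n} x_i² + 2·Σ_{i≤n} x_i v_i = (1 − ρ²)·Σ_{i≤n} u_i² + ρ²·u_n²` and
`Σ_{i≤n} x_i² ≤ (1 + ρ)²·Σ_{i≤n} u_i² − ρ(1 + ρ)·u_n²`. -/
theorem causal_filter_aux {ρ : ℝ} (hρ : 0 ≤ ρ) (x v : ℕ → ℝ) (hv0 : v 0 = 0) :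
    ∀ n : ℕ, (∀ i < n, v (i + 1) = ρ * (v i + x i)) →
      (∑ i ∈ Finset.range (n + 1), x i ^ 2 + 2 * ∑ i ∈ Finset.range (n + 1), x i * v i =
          (1 - ρ ^ 2) * ∑ i ∈ Finset.range (n + 1), (x i + v i) ^ 2 + ρ ^ 2 * (x n + v n) ^ 2) ∧
        ∑ i ∈ Finset.range (n + 1), x i ^ 2 ≤
          (1 + ρ) ^ 2 * ∑ i ∈ Finset.range (n + 1), (x i + v i) ^ 2 - ρ * (1 + ρ) * (x n + v n) ^ 2 := by
  intro n
  induction n with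
  | zero =>
    intro _
    simp only [zero_add, Finset.sum_range_one, hv0, add_zero, mul_zero]
    constructor
    · ring
    · nlinarith [mul_nonneg hρ (sq_nonneg (x 0))]
  | succ n ih =>
    intro hrec
    obtain ⟨h1, h2⟩ := ih fun i hi ↦ hrec i (Nat.lt_succ_of_lt hi)
    have hr : v (n + 1) = ρ * (v n + x n) := hrec n n.lt_succ_self
    rw [Finset.sum_range_succ _ (n + 1), Finset.sum_range_succ _ (n + 1),
      Finset.sum_range_succ (fun i ↦ (x i + v i) ^ 2) (n + 1)]
    constructor
    · linear_combination h1 - (v (n + 1) + ρ * (v n + x n)) * hr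
    · have key : x (n + 1) ^ 2 ≤ (1 + ρ) * (x (n + 1) + v (n + 1)) ^ 2 + ρ * (1 + ρ) * (x n + v n) ^ 2 := by
        rw [hr]
        nlinarith [mul_nonneg hρ (sq_nonneg (x (n + 1) + ρ * (v n + x n) + (v n + x n)))]
      nlinarith [h2, key]

/-- **KMS lower bound, causal form.** With `v` as in `causal_filter_aux` and `0 ≤ ρ ≤ 1`:
`((1−ρ)/(1+ρ))·Σ_{i≤n} x_i² ≤ Σ_{i≤n} x_i² + 2·Σ_{i≤n} x_i v_i` — the right side is `xᵀ K_{n+1}(ρ) x`. -/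
theorem kms_causal_lower {ρ : ℝ} (hρ : 0 ≤ ρ) (hρ1 : ρ ≤ 1) (x v : ℕ → ℝ) (hv0 : v 0 = 0) (n : ℕ)
    (hrec : ∀ i < n, v (i + 1) = ρ * (v i + x i)) :
    (1 - ρ) / (1 + ρ) * ∑ i ∈ Finset.range (n + 1), x i ^ 2 ≤
      ∑ i ∈ Finset.range (n + 1), x i ^ 2 + 2 * ∑ i ∈ Finset.range (n + 1), x i * v i := by
  obtain ⟨h1, h2⟩ := causal_filter_aux hρ x v hv0 n hrec
  rw [h1]
  have h1ρ : (1 + ρ) ≠ 0 := by positivity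
  have hc0 : 0 ≤ (1 - ρ) / (1 + ρ) := div_nonneg (by linarith) (by linarith)
  have hX : ∑ i ∈ Finset.range (n + 1), x i ^ 2 ≤ (1 + ρ) ^ 2 * ∑ i ∈ Finset.range (n + 1), (x i + v i) ^ 2 := by
    nlinarith [h2, mul_nonneg hρ (sq_nonneg (x n + v n))]
  have hc := mul_le_mul_of_nonneg_left hX hc0
  have hid : (1 - ρ) / (1 + ρ) * ((1 + ρ) ^ 2 * ∑ i ∈ Finset.range (n + 1), (x i + v i) ^ 2) =
      (1 - ρ ^ 2) * ∑ i ∈ Finset.range (n + 1), (x i + v i) ^ 2 := by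
    field_simp
    ring
  have h3 : 0 ≤ ρ ^ 2 * (x n + v n) ^ 2 := mul_nonneg (sq_nonneg ρ) (sq_nonneg _)
  linarith

/-- **KMS lower bound, anticausal form** (the reflection `i ↦ n − i` of `kms_causal_lower`): if `t_n = 0` and
`t_i = ρ·(t_{i+1} + x_{i+1})` for `i < n`, then `((1−ρ)/(1+ρ))·Σ x_i² ≤ Σ x_i² + 2·Σ x_i t_i`. -/
theorem kms_anticausal_lower {ρ : ℝ} (hρ : 0 ≤ ρ) (hρ1 : ρ ≤ 1) (x t : ℕ → ℝ) (n : ℕ) (htn : t n = 0)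
    (hrec : ∀ i < n, t i = ρ * (t (i + 1) + x (i + 1))) :
    (1 - ρ) / (1 + ρ) * ∑ i ∈ Finset.range (n + 1), x i ^ 2 ≤
      ∑ i ∈ Finset.range (n + 1), x i ^ 2 + 2 * ∑ i ∈ Finset.range (n + 1), x i * t i := by
  have h := kms_causal_lower hρ hρ1 (fun i ↦ x (n - i)) (fun i ↦ t (n - i)) (by simp [htn]) n (by
    intro i hi
    have hj : n - (i + 1) + 1 = n - i := by omega
    have := hrec (n - (i + 1)) (by omega)
    rw [hj] at this
    simpa using this)
  have hx : ∑ i ∈ Finset.range (n + 1), x (n - i) ^ 2 = ∑ i ∈ Finset.range (n + 1), x i ^ 2 := by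
    simpa using Finset.sum_range_reflect (fun i ↦ x i ^ 2) (n + 1)
  have hxt : ∑ i ∈ Finset.range (n + 1), x (n - i) * t (n - i) = ∑ i ∈ Finset.range (n + 1), x i * t i := by
    simpa using Finset.sum_range_reflect (fun i ↦ x i * t i) (n + 1)
  simpa [hx, hxt] using h

/-- **The constant is optimal (alternating vectors).** For `x_i = (−1)^i` the causal filter is
`u_i = (−1)^i (1 − (−ρ)^{i+1})/(1 + ρ)`, and `Σ_{i≤n} x_i² + 2Σ_{i≤n} x_i v_i = ((1−ρ)/(1+ρ))·(n+1) + 2ρ(1 − (−ρ)^{n+1})/(1+ρ)²` EXACTLY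
(`v = u − x`): the excess over `((1−ρ)/(1+ρ))·Σ x_i²` stays bounded while `Σ x_i² = n + 1 → ∞`, so no constant larger than `(1−ρ)/(1+ρ)` works in
`kms_causal_lower` (the fibre form of §2 is the sum of a causal and an anticausal copy, so `2ρ/(1+ρ)`, i.e. `2·log p/(√p + 1)`, is the best
window-independent deletion constant — the sharp window-by-window floors `−λ_min(A_m(p))` increase to it). -/
theorem kms_causal_alternating {ρ : ℝ} (hρ : 0 ≤ ρ) (n : ℕ) :
    let x : ℕ → ℝ := fun i ↦ (-1) ^ i
    let v : ℕ → ℝ := fun i ↦ (-1) ^ i * (1 - (-ρ) ^ (i + 1)) / (1 + ρ) - (-1) ^ i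
    v 0 = 0 ∧ (∀ i, v (i + 1) = ρ * (v i + x i)) ∧
      ∑ i ∈ Finset.range (n + 1), x i ^ 2 + 2 * ∑ i ∈ Finset.range (n + 1), x i * v i =
        (1 - ρ) / (1 + ρ) * (n + 1) + 2 * ρ * (1 - (-ρ) ^ (n + 1)) / (1 + ρ) ^ 2 := by
  intro x v
  have h1 : (1 + ρ) ≠ 0 := by positivity
  refine ⟨?_, ?_, ?_⟩
  · simp only [v, pow_zero, zero_add, pow_one, one_mul]
    field_simp
    ring
  · intro i
    simp only [v, x]
    field_simp
    ring
  · -- termwise: x_i² + 2 x_i v_i = (1−ρ)/(1+ρ) − 2(−ρ)^{i+1}/(1+ρ)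
    have hterm : ∀ i : ℕ, x i ^ 2 + 2 * (x i * v i) = (1 - ρ) / (1 + ρ) - 2 / (1 + ρ) * (-ρ) ^ (i + 1) := by
      intro i
      simp only [x, v]
      rcases neg_one_pow_eq_or ℝ i with h | h <;> rw [h] <;> field_simp <;> ring
    rw [Finset.mul_sum, ← Finset.sum_add_distrib, Finset.sum_congr rfl fun i _ ↦ hterm i, Finset.sum_sub_distrib,
      Finset.sum_const, Finset.card_range, ← Finset.mul_sum]
    have hgeom : ∑ i ∈ Finset.range (n + 1), (-ρ) ^ (i + 1) = (-ρ) * (((-ρ) ^ (n + 1) - 1) / ((-ρ) - 1)) := by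
      rw [← geom_sum_eq (by linarith : (-ρ : ℝ) ≠ 1) (n + 1), Finset.mul_sum]
      exact Finset.sum_congr rfl fun i _ ↦ by ring
    rw [hgeom, nsmul_eq_mul]
    have h2 : (-ρ : ℝ) - 1 ≠ 0 := by linarith
    push_cast
    field_simp
    ring

/-! ## §2  The fibre certificate `A_m(p) ⪰ −2·log p/(√p + 1)` for every `m` -/

/-- **Real fibre form, every `m`:** for `x : ℤ → ℝ` supported in `{0,…,m}` and `0 ≤ ρ ≤ 1`,
`(2ρ/(1+ρ))·Σ_i x_i² + Σ_{e<m} ρ^{e+1}·Σ_i (x_i x_{i−e−1} + x_i x_{i+e+1}) ≥ 0`, i.e. `K_{m+1}(ρ) − I ⪰ −(2ρ/(1+ρ))·I`. -/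
theorem kms_offdiag_real {ρ : ℝ} (hρ : 0 ≤ ρ) (hρ1 : ρ ≤ 1) (m : ℕ) (x : ℤ → ℝ) (hx1 : ∀ n : ℤ, n < 0 → x n = 0)
    (hx2 : ∀ n : ℤ, (m : ℤ) < n → x n = 0) :
    0 ≤ 2 * ρ / (1 + ρ) * ∑ i ∈ Finset.range (m + 1), x i ^ 2 +
      ∑ e ∈ Finset.range m, ρ ^ (e + 1) *
        ∑ i ∈ Finset.range (m + 1), (x i * x ((i : ℤ) - (e + 1)) + x i * x ((i : ℤ) + (e + 1))) := by
  have h1ρ : (1 + ρ) ≠ 0 := by positivity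
  have hkey : 2 * ρ / (1 + ρ) = 1 - (1 - ρ) / (1 + ρ) := by field_simp; ring
  -- the causal and anticausal filters of `x`
  set v : ℕ → ℝ := fun i ↦ ∑ e ∈ Finset.range m, ρ ^ (e + 1) * x ((i : ℤ) - (e + 1)) with hvdef
  set t : ℕ → ℝ := fun i ↦ ∑ e ∈ Finset.range m, ρ ^ (e + 1) * x ((i : ℤ) + (e + 1)) with htdef
  have hsplit : ∑ e ∈ Finset.range m, ρ ^ (e + 1) *
        ∑ i ∈ Finset.range (m + 1), (x i * x ((i : ℤ) - (e + 1)) + x i * x ((i : ℤ) + (e + 1))) =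
      ∑ i ∈ Finset.range (m + 1), x i * v i + ∑ i ∈ Finset.range (m + 1), x i * t i := by
    have hA : ∑ e ∈ Finset.range m, ρ ^ (e + 1) * ∑ i ∈ Finset.range (m + 1), x i * x ((i : ℤ) - (e + 1)) =
        ∑ i ∈ Finset.range (m + 1), x i * v i := by
      simp only [hvdef, Finset.mul_sum]
      rw [Finset.sum_comm]
      exact Finset.sum_congr rfl fun i _ ↦ Finset.sum_congr rfl fun e _ ↦ by ring
    have hB : ∑ e ∈ Finset.range m, ρ ^ (e + 1) * ∑ i ∈ Finset.range (m + 1), x i * x ((i : ℤ) + (e + 1)) =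
        ∑ i ∈ Finset.range (m + 1), x i * t i := by
      simp only [htdef, Finset.mul_sum]
      rw [Finset.sum_comm]
      exact Finset.sum_congr rfl fun i _ ↦ Finset.sum_congr rfl fun e _ ↦ by ring
    rw [← hA, ← hB, ← Finset.sum_add_distrib]
    exact Finset.sum_congr rfl fun e _ ↦ by rw [Finset.sum_add_distrib, mul_add]
  rw [hsplit]
  rcases Nat.eq_zero_or_pos m with rfl | hm
  · simp only [hvdef, htdef, Finset.range_zero, Finset.sum_empty, mul_zero, Finset.sum_const_zero, add_zero]
    exact mul_nonneg (div_nonneg (by linarith) (by linarith)) (Finset.sum_nonneg fun _ _ ↦ sq_nonneg _)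
  obtain ⟨k, rfl⟩ := Nat.exists_eq_succ_of_ne_zero hm.ne'
  -- recursions of the causal filter
  have hv0 : v 0 = 0 := by
    simp only [hvdef]
    exact Finset.sum_eq_zero fun e _ ↦ by rw [hx1 _ (by push_cast; omega), mul_zero]
  have hvrec : ∀ i < k + 1, v (i + 1) = ρ * (v i + x i) := by
    intro i hi
    have hz : x ((i : ℤ) - ((k : ℕ) + 1)) = 0 := hx1 _ (by omega)
    simp only [hvdef]
    rw [Finset.sum_range_succ', Finset.sum_range_succ, hz, mul_zero, add_zero, mul_add, Finset.mul_sum]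
    congr 1
    · refine Finset.sum_congr rfl fun e _ ↦ ?_
      have : (((i + 1 : ℕ) : ℤ) - (((e + 1 : ℕ) : ℤ) + 1)) = (i : ℤ) - ((e : ℤ) + 1) := by push_cast; ring
      rw [this]; ring
    · have : (((i + 1 : ℕ) : ℤ) - (((0 : ℕ) : ℤ) + 1)) = (i : ℤ) := by push_cast; ring
      rw [this]; ring
  -- recursions of the anticausal filter
  have htm : t (k + 1) = 0 := by
    simp only [htdef]
    exact Finset.sum_eq_zero fun e _ ↦ by rw [hx2 _ (by push_cast; omega), mul_zero]
  have htrec : ∀ i < k + 1, t i = ρ * (t (i + 1) + x (i + 1)) := by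
    intro i _
    have hz : x (((i + 1 : ℕ) : ℤ) + ((k : ℕ) + 1)) = 0 := hx2 _ (by push_cast; omega)
    simp only [htdef]
    rw [Finset.sum_range_succ', Finset.sum_range_succ, hz, mul_zero, add_zero, mul_add, Finset.mul_sum]
    congr 1
    · refine Finset.sum_congr rfl fun e _ ↦ ?_
      have : ((i : ℤ) + (((e + 1 : ℕ) : ℤ) + 1)) = ((i + 1 : ℕ) : ℤ) + ((e : ℤ) + 1) := by push_cast; ring
      rw [this]; ring
    · have : ((i : ℤ) + (((0 : ℕ) : ℤ) + 1)) = (i : ℤ) + 1 := by push_cast; ring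
      rw [this]; ring
  have hc := kms_causal_lower hρ hρ1 (fun i : ℕ ↦ x i) v hv0 (k + 1) hvrec
  have ha := kms_anticausal_lower hρ hρ1 (fun i : ℕ ↦ x i) t (k + 1) htm htrec
  rw [hkey]
  nlinarith [hc, ha]

/-- **The uniform fibre certificate:** for every prime `p`, every `m`, every `G : ℤ → ℂ` supported in `{0,…,m}`:
`(2·log p/(√p + 1))·Σ‖G_i‖² + Σ_{e<m} (log p/√(p^{e+1}))·Σ_i Re(G_i Ḡ_{i−e−1} + G_i Ḡ_{i+e+1}) ≥ 0` — i.e.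
`A_m(p) ⪰ −(2·log p/(√p + 1))·I`, the hypothesis of `re_weilSemilocalQuadratic_erase_ge_of_cert` with `μ = 2·log p/(√p + 1)`. -/
theorem cert_uniform {p : ℕ} (hp : p.Prime) (m : ℕ) (G : ℤ → ℂ) (hG1 : ∀ n : ℤ, n < 0 → G n = 0)
    (hG2 : ∀ n : ℤ, (m : ℤ) < n → G n = 0) :
    0 ≤ 2 * Real.log p / (Real.sqrt p + 1) * ∑ i ∈ Finset.range (m + 1), ‖G i‖ ^ 2 +
      ∑ e ∈ Finset.range m, Real.log p / Real.sqrt ((p : ℝ) ^ (e + 1)) *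
        ∑ i ∈ Finset.range (m + 1), (G i * conj (G ((i : ℤ) - (e + 1))) + G i * conj (G ((i : ℤ) + (e + 1)))).re := by
  have hp0 : (0 : ℝ) < p := by exact_mod_cast hp.pos
  have hp1 : (1 : ℝ) ≤ p := by exact_mod_cast hp.one_lt.le
  have hL : 0 ≤ Real.log p := Real.log_nonneg hp1
  have hs1 : 1 ≤ Real.sqrt p := by rw [← Real.sqrt_one]; exact Real.sqrt_le_sqrt hp1
  have hs0 : 0 < Real.sqrt p := by linarith
  set ρ : ℝ := (Real.sqrt p)⁻¹ with hρdef
  have hρ0 : 0 ≤ ρ := inv_nonneg.mpr hs0.le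
  have hρ1 : ρ ≤ 1 := inv_le_one_of_one_le₀ hs1
  -- the weights and the constant in terms of `ρ`
  have hw : ∀ e : ℕ, Real.log p / Real.sqrt ((p : ℝ) ^ (e + 1)) = Real.log p * ρ ^ (e + 1) := by
    intro e
    have : Real.sqrt ((p : ℝ) ^ (e + 1)) = Real.sqrt p ^ (e + 1) := by
      rw [show ((p : ℝ) ^ (e + 1)) = (Real.sqrt p ^ (e + 1)) ^ 2 by
        rw [← pow_mul, mul_comm, pow_mul, Real.sq_sqrt hp0.le], Real.sqrt_sq (pow_nonneg hs0.le _)]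
    rw [this, hρdef, inv_pow, div_eq_mul_inv]
  have hμ : 2 * Real.log p / (Real.sqrt p + 1) = Real.log p * (2 * ρ / (1 + ρ)) := by
    rw [hρdef]
    field_simp
  -- real and imaginary parts
  have hre := kms_offdiag_real hρ0 hρ1 m (fun n ↦ (G n).re) (fun n hn ↦ by simp [hG1 n hn]) (fun n hn ↦ by simp [hG2 n hn])
  have him := kms_offdiag_real hρ0 hρ1 m (fun n ↦ (G n).im) (fun n hn ↦ by simp [hG1 n hn]) (fun n hn ↦ by simp [hG2 n hn])
  have hnorm : ∀ i : ℕ, ‖G i‖ ^ 2 = (G i).re ^ 2 + (G i).im ^ 2 := fun i ↦ by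
    rw [Complex.sq_norm, Complex.normSq_apply]; ring
  have hprod : ∀ a b : ℤ, (G a * conj (G b)).re = (G a).re * (G b).re + (G a).im * (G b).im := fun a b ↦ by
    simp only [Complex.mul_re, Complex.conj_re, Complex.conj_im]; ring
  have hsum := mul_nonneg hL (add_nonneg hre him)
  simp only [hw, hnorm, Complex.add_re, hprod, hμ]
  simp only [Finset.mul_sum, mul_add, Finset.sum_add_distrib] at hsum ⊢
  simp only [mul_assoc] at hsum ⊢
  simp only [← Finset.mul_sum] at hsum ⊢
  linarith

/-! ## §3  The all-window deletion floor -/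

variable {g : ℝ → ℂ}

/-- **All-window deletion floor, `Q`-form:** for every prime `p ∈ S` and every Weil test function `g` of compact support
(any window): `Re Q_{S∖{p}}(g) ≥ Re Q_S(g) − (2·log p/(√p + 1))·‖g‖₂²`. -/
theorem re_weilSemilocalQuadratic_erase_ge_uniform (hg : IsWeilTest g) {S : Finset ℕ} {p : ℕ} (hp : p.Prime) (hpS : p ∈ S)
    {c : ℝ} (hsupp : tsupport g ⊆ Icc (-c) c) :
    (weilSemilocalQuadratic S g).re - 2 * Real.log p / (Real.sqrt p + 1) * ∫ u : ℝ, ‖g u‖ ^ 2 ≤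
      (weilSemilocalQuadratic (S.erase p) g).re := by
  have hL : 0 < Real.log p := Real.log_pos (by exact_mod_cast hp.one_lt)
  obtain ⟨m, hm⟩ := exists_nat_gt (2 * c / Real.log p)
  have hm' : 2 * c < (m + 1) * Real.log p := by
    have := (div_lt_iff₀ hL).1 hm
    nlinarith
  exact re_weilSemilocalQuadratic_erase_ge_of_cert hg hp hpS hsupp hm' fun G hG1 hG2 ↦ cert_uniform hp m G hG1 hG2

/-- **All-window deletion floor, hypothesis-free form:** for EVERY Weil test function `g` (smooth, compact support) and every
prime `p ∈ S`: `Re Q_{S∖{p}}(g) ≥ Re Q_S(g) − (2·log p/(√p + 1))·‖g‖₂²`. -/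
theorem re_weilSemilocalQuadratic_erase_ge_uniform' (hg : IsWeilTest g) {S : Finset ℕ} {p : ℕ} (hp : p.Prime) (hpS : p ∈ S) :
    (weilSemilocalQuadratic S g).re - 2 * Real.log p / (Real.sqrt p + 1) * ∫ u : ℝ, ‖g u‖ ^ 2 ≤
      (weilSemilocalQuadratic (S.erase p) g).re := by
  obtain ⟨c, hc⟩ := (Metric.isBounded_iff_subset_closedBall (0 : ℝ)).1 hg.2.isCompact.isBounded
  rw [Real.closedBall_eq_Icc, zero_sub, zero_add] at hc
  exact re_weilSemilocalQuadratic_erase_ge_uniform hg hp hpS hc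

variable {P : (ℝ → ℂ) → Prop}

/-- **All-window deletion floor for the bottoms:** for every prime `p ∈ S`, every `c` and every constraint `P`:
`λ_min(S∖{p}; c; P) ≥ λ_min(S; c; P) − 2·log p/(√p + 1)`.  (`p = 2`: `0.5742`; `3`: `0.8042`; `5`: `0.9947`; `7`: `1.0675`.) -/
theorem semilocalGroundEnergy_erase_ge_uniform {S : Finset ℕ} {p : ℕ} (hp : p.Prime) (hpS : p ∈ S) (c : ℝ) :
    semilocalGroundEnergy S P c - 2 * Real.log p / (Real.sqrt p + 1) ≤ semilocalGroundEnergy (S.erase p) P c := by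
  have hL : 0 < Real.log p := Real.log_pos (by exact_mod_cast hp.one_lt)
  obtain ⟨m, hm⟩ := exists_nat_gt (2 * c / Real.log p)
  have hm' : 2 * c < (m + 1) * Real.log p := by
    have := (div_lt_iff₀ hL).1 hm
    nlinarith
  exact semilocalGroundEnergy_erase_ge_of_cert hp hpS hm' (by positivity) fun G hG1 hG2 ↦ cert_uniform hp m G hG1 hG2

/-- **Deleting a set of primes, every window:** for finite `S`, a finite set `T` of primes, every `c` and every `P`:
`λ_min(S∖T; c; P) ≥ λ_min(S; c; P) − Σ_{p ∈ T} 2·log p/(√p + 1)`. -/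
theorem semilocalGroundEnergy_sdiff_ge_uniform {S T : Finset ℕ} (hT : ∀ p ∈ T, p.Prime) (c : ℝ) :
    semilocalGroundEnergy S P c - ∑ p ∈ T, 2 * Real.log p / (Real.sqrt p + 1) ≤ semilocalGroundEnergy (S \ T) P c := by
  induction T using Finset.induction_on with
  | empty => simp
  | @insert a T haT ih =>
    have ih' := ih fun p hp ↦ hT p (Finset.mem_insert_of_mem hp)
    have ha : a.Prime := hT a (Finset.mem_insert_self a T)
    rw [Finset.sum_insert haT, Finset.sdiff_insert]
    have hcost : 0 ≤ 2 * Real.log a / (Real.sqrt a + 1) :=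
      div_nonneg (mul_nonneg (by norm_num) (Real.log_nonneg (by exact_mod_cast ha.one_lt.le))) (by positivity)
    by_cases haS : a ∈ S \ T
    · have := semilocalGroundEnergy_erase_ge_uniform (P := P) ha haS c
      linarith
    · rw [Finset.erase_eq_of_notMem haS]
      linarith

/-- **Monotonicity with an explicit modulus:** for finite sets of primes `S ⊆ S'`, every `c` and every `P`:
`λ_min(S; c; P) ≥ λ_min(S'; c; P) − Σ_{p ∈ S'∖S} 2·log p/(√p + 1)` — in particular (`S = ∅`) every prime-full bottom lies at most
`Σ_{p∈S'} 2·log p/(√p + 1)` above the archimedean-only bottom `λ_min(∅; c; P)`. -/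
theorem semilocalGroundEnergy_ge_of_subset_uniform {S S' : Finset ℕ} (hSS' : S ⊆ S') (hS' : ∀ p ∈ S', p.Prime) (c : ℝ) :
    semilocalGroundEnergy S' P c - ∑ p ∈ S' \ S, 2 * Real.log p / (Real.sqrt p + 1) ≤ semilocalGroundEnergy S P c := by
  have h := semilocalGroundEnergy_sdiff_ge_uniform (P := P) (S := S') (T := S' \ S) (fun p hp ↦ hS' p (Finset.sdiff_subset hp)) c
  rwa [Finset.sdiff_sdiff_eq_self hSS'] at h

/-- **The primes' total budget:** for a finite set `S` of primes, every `c` and every `P`, the prime-full bottom exceeds the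
prime-free (archimedean-only) bottom by at most `Σ_{p∈S} 2·log p/(√p + 1)`: `λ_min(S; c; P) ≤ λ_min(∅; c; P) + Σ_{p∈S} 2·log p/(√p + 1)`. -/
theorem semilocalGroundEnergy_le_empty_add_sum {S : Finset ℕ} (hS : ∀ p ∈ S, p.Prime) (c : ℝ) :
    semilocalGroundEnergy S P c ≤ semilocalGroundEnergy ∅ P c + ∑ p ∈ S, 2 * Real.log p / (Real.sqrt p + 1) := by
  have h := semilocalGroundEnergy_ge_of_subset_uniform (P := P) (Finset.empty_subset S) hS c
  rw [Finset.sdiff_empty] at h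
  linarith

end Summit.RiemannHypothesis.RiemannHypothesis.Theorems.SemilocalDeletionToeplitzFloorUniform
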